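import Summits.CriticalPhenomena.PercolationContinuityZ3.Theorems.PercNearOneGluingNoHeavyLowerTailSahiSunflowerFourAllOrders
import Literature.Combinatorics.Sahi2008.Percolation
import Literature.Combinatorics.Sahi2008.PushForward
import Mathlib.Tactic.FinCases
import HarnessLib

/-!
# `NoHeavyLowerTail` (crux stmt-CriticalPhenomena-4575), master-family line P2: every order of Sahi's hierarchy on the FOUR-POINT
# "all-but-one-joined" pattern algebra of a finite weighted graph is equivalent to the single row `4PT-LB`

Support file (seat `prim-masterthm-p2`, gen 3; `--supports stmt-CriticalPhenomena-4575`); no named fact, no sorry.  Memo SAHI-ROUTE.md §4.10–4.12.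
Companions: `…SahiSunflowerFourPoint` (the pattern map `pat4 a b c d : BondConfig V → M4`, `pat4_quartic_eq`, the `@[conjecture]` row `FourPointLBRow`
= `0 ≤ E₄(D_a, D_b, D_c, D_d)`, `D_x = {the three terminals other than x are not all joined}`) and `…SahiSunflowerFourAllOrders` (the `M₄` hierarchy
theorem `M4.sahiPositive_iff_two_and_row`).

* `pat4_anti` — the pattern map is ANTITONE in the configuration (more open edges: `out → pet → core`), so Harris for decreasing events transports to
  order `2` of the pattern weight (`sahiPositive_two_pat4`);
* **`sahiPositive_pat4_iff`** — for every finite weighted graph and `a b c d`: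
  `(∀ n, SahiPositive (pattern weight) n) ↔ 0 ≤ sahiE4 (prodBernoulli w) D_a D_b D_c D_d` (= `4PT-LB` at `(w; a, b, c, d)`);
* `sahiE_fourPointPattern_nonneg_of_row` — given the row at `(w; a, b, c, d)`, `E_n(f₀ ∘ pat4, …, f_{n−1} ∘ pat4) ≥ 0` for every `n` and all nonnegative
  `f_i : M₄ → ℝ` increasing from `core` to `out` (all nonnegative pattern-measurable functions DECREASING in the configuration: every multiset of the
  indicators of `D_x`, "no three of `a,b,c,d` joined", "`x` is cut off from the other three or nothing is joined", …);
* `fourPointLBRow_iff_allOrders` — the open row `FourPointLBRow` is EQUIVALENT to "the 4-point all-but-one-joined pattern weight of every finite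
  weighted graph is Sahi-positive of every order": the `m = 4` rung of the sunflower tower carries its whole hierarchy, as `3PT-LB` does at `m = 3`
  (`sahiPositive_pat3`).  Nothing open is used except by name; `FourPointLBRow` stays `[status: open]` (census-clean: ttrl cp-e4, 1.16e7 exact evaluations).
-/

namespace Summit.CriticalPhenomena.PercolationContinuityZ3.Theorems.SahiDeltaSystem

open Finset Function MeasureTheory Literature.Combinatorics.Sahi2008
open Literature.Probability.LatticeModels (prodBernoulli sahiE4)
open Literature.Probability.Percolation
open M4

variable {V : Type*} [Fintype V]

omit [Fintype V] in
/-- The triple-connection events are increasing. [this work] -/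
theorem isUpperSet_triConn (x y z : V) : IsUpperSet (triConn x y z : Set (BondConfig V)) :=
  (isUpperSet_openConn x y).inter (isUpperSet_openConn y z)

/-- Everything is below `out`. [this work] -/
theorem M4.le_out : ∀ y : M4, y ≤ out := by decide

/-- `core` is below everything. [this work] -/
theorem M4.core_le : ∀ y : M4, core ≤ y := by decide

section PatValues

variable (a b c d : V) {ω : BondConfig V}

omit [Fintype V] in
/-- Value of the pattern map: all four terminals joined. [this work] -/
theorem pat4_eq_core (h0 : ω ∈ triConn b c d) (h1 : ω ∈ triConn a c d) : pat4 a b c d ω = core := by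
  unfold pat4; simp [h0, h1]

omit [Fintype V] in
/-- Value of the pattern map: exactly `b c d` joined. [this work] -/
theorem pat4_eq_pet0 (h0 : ω ∈ triConn b c d) (h1 : ω ∉ triConn a c d) : pat4 a b c d ω = pet 0 := by
  unfold pat4; simp [h0, h1]

omit [Fintype V] in
/-- Value of the pattern map: exactly `a c d` joined. [this work] -/
theorem pat4_eq_pet1 (h0 : ω ∉ triConn b c d) (h1 : ω ∈ triConn a c d) : pat4 a b c d ω = pet 1 := by
  unfold pat4; simp [h0, h1]

omit [Fintype V] in
/-- Value of the pattern map: exactly `a b d` joined. [this work] -/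
theorem pat4_eq_pet2 (h0 : ω ∉ triConn b c d) (h1 : ω ∉ triConn a c d) (h2 : ω ∈ triConn a b d) :
    pat4 a b c d ω = pet 2 := by
  unfold pat4; simp [h0, h1, h2]

omit [Fintype V] in
/-- Value of the pattern map: exactly `a b c` joined. [this work] -/
theorem pat4_eq_pet3 (h0 : ω ∉ triConn b c d) (h1 : ω ∉ triConn a c d) (h2 : ω ∉ triConn a b d) (h3 : ω ∈ triConn a b c) :
    pat4 a b c d ω = pet 3 := by
  unfold pat4; simp [h0, h1, h2, h3]

omit [Fintype V] in
/-- Value of the pattern map: no triple joined. [this work] -/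
theorem pat4_eq_out (h0 : ω ∉ triConn b c d) (h1 : ω ∉ triConn a c d) (h2 : ω ∉ triConn a b d) (h3 : ω ∉ triConn a b c) :
    pat4 a b c d ω = out := by
  unfold pat4; simp [h0, h1, h2, h3]

end PatValues

omit [Fintype V] in
/-- **The four-point pattern map is antitone**: opening edges moves the pattern down `out → pet i → core` (two distinct joined triples force all four
terminals into one cluster). [this work] -/
theorem pat4_anti (a b c d : V) {ω ω' : BondConfig V} (hle : ω ≤ ω') : pat4 a b c d ω' ≤ pat4 a b c d ω := by
  have R : ∀ {η : BondConfig V} {x y : V}, η ∈ openConn x y → (openGraph η).Reachable x y := fun h => h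
  have M : ∀ {η : BondConfig V} {x y : V}, (openGraph η).Reachable x y → η ∈ openConn x y := fun h => h
  have m0 : ω ∈ triConn b c d → ω' ∈ triConn b c d := fun h => isUpperSet_triConn b c d hle h
  have m1 : ω ∈ triConn a c d → ω' ∈ triConn a c d := fun h => isUpperSet_triConn a c d hle h
  have m2 : ω ∈ triConn a b d → ω' ∈ triConn a b d := fun h => isUpperSet_triConn a b d hle h
  have m3 : ω ∈ triConn a b c → ω' ∈ triConn a b c := fun h => isUpperSet_triConn a b c hle h
  -- two distinct joined triples among `a b c d` join everything (the five instances used)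
  have v02 : ω' ∈ triConn b c d → ω' ∈ triConn a b d → ω' ∈ triConn a c d := fun h0 h2 =>
    ⟨M ((R h2.1).trans (R h0.1)), h0.2⟩
  have v12 : ω' ∈ triConn a c d → ω' ∈ triConn a b d → ω' ∈ triConn b c d := fun h1 h2 =>
    ⟨M ((R h2.1).symm.trans (R h1.1)), h1.2⟩
  have v03 : ω' ∈ triConn b c d → ω' ∈ triConn a b c → ω' ∈ triConn a c d := fun h0 h3 =>
    ⟨M ((R h3.1).trans (R h3.2)), h0.2⟩
  have v13 : ω' ∈ triConn a c d → ω' ∈ triConn a b c → ω' ∈ triConn b c d := fun h1 h3 =>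
    ⟨h3.2, h1.2⟩
  have v23 : ω' ∈ triConn a b d → ω' ∈ triConn a b c → ω' ∈ triConn b c d := fun h2 h3 =>
    ⟨h3.2, M ((R h3.2).symm.trans (R h2.2))⟩
  by_cases h0 : ω ∈ triConn b c d
  · by_cases h1 : ω ∈ triConn a c d
    · rw [pat4_eq_core a b c d h0 h1, pat4_eq_core a b c d (m0 h0) (m1 h1)]
    · rw [pat4_eq_pet0 a b c d h0 h1]
      by_cases k1 : ω' ∈ triConn a c d
      · rw [pat4_eq_core a b c d (m0 h0) k1]; exact M4.core_le _
      · rw [pat4_eq_pet0 a b c d (m0 h0) k1]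
  · by_cases h1 : ω ∈ triConn a c d
    · rw [pat4_eq_pet1 a b c d h0 h1]
      by_cases k0 : ω' ∈ triConn b c d
      · rw [pat4_eq_core a b c d k0 (m1 h1)]; exact M4.core_le _
      · rw [pat4_eq_pet1 a b c d k0 (m1 h1)]
    · by_cases h2 : ω ∈ triConn a b d
      · rw [pat4_eq_pet2 a b c d h0 h1 h2]
        have k2 := m2 h2
        by_cases k0 : ω' ∈ triConn b c d
        · rw [pat4_eq_core a b c d k0 (v02 k0 k2)]; exact M4.core_le _
        · by_cases k1 : ω' ∈ triConn a c d
          · exact absurd (v12 k1 k2) k0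
          · rw [pat4_eq_pet2 a b c d k0 k1 k2]
      · by_cases h3 : ω ∈ triConn a b c
        · rw [pat4_eq_pet3 a b c d h0 h1 h2 h3]
          have k3 := m3 h3
          by_cases k0 : ω' ∈ triConn b c d
          · rw [pat4_eq_core a b c d k0 (v03 k0 k3)]; exact M4.core_le _
          · by_cases k1 : ω' ∈ triConn a c d
            · exact absurd (v13 k1 k3) k0
            · by_cases k2 : ω' ∈ triConn a b d
              · exact absurd (v23 k2 k3) k0
              · rw [pat4_eq_pet3 a b c d k0 k1 k2 k3]
        · rw [pat4_eq_out a b c d h0 h1 h2 h3]; exact M4.le_out _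

omit [Fintype V] in
/-- The pattern map is monotone on the order dual of the configuration space. [this work] -/
theorem monotone_pat4_toDual (a b c d : V) : Monotone (fun x : (BondConfig V)ᵒᵈ => pat4 a b c d (OrderDual.ofDual x)) :=
  fun _ _ hxy => pat4_anti a b c d hxy

/-- **Order `2` of the four-point pattern weight** (Harris for decreasing events, transported along the antitone pattern map). [this work] -/
theorem sahiPositive_two_pat4 (w : Sym2 V → unitInterval) (a b c d : V) :
    SahiPositive (pushWeight (bernoulliWeight w) (pat4 a b c d)) 2 := by
  have h := SahiPositive.of_pushWeight (sahiPositive_two (isFKGMeasure_bernoulliWeightDual w)) (monotone_pat4_toDual a b c d)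
  exact h

/-- The pattern weight is a probability weight: nonnegative. [this work] -/
theorem pushWeight_pat4_nonneg (w : Sym2 V → unitInterval) (a b c d : V) (x : M4) :
    0 ≤ pushWeight (bernoulliWeight w) (pat4 a b c d) x :=
  pushWeight_nonneg (isFKGMeasure_bernoulliWeight w).nonneg _ x

/-- The pattern weight is a probability weight: total mass one. [this work] -/
theorem sum_pushWeight_pat4 (w : Sym2 V → unitInterval) (a b c d : V) :
    ∑ x, pushWeight (bernoulliWeight w) (pat4 a b c d) x = 1 := by
  rw [sum_pushWeight, sum_bernoulliWeight]

/-- **Four-point pattern algebra: all orders ⟺ `4PT-LB`.**  For every finite weighted graph and vertices `a b c d`: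
`(∀ n, SahiPositive (pattern weight) n) ↔ 0 ≤ E₄(D_a, D_b, D_c, D_d)`, `D_x = (triConn of the other three)ᶜ`. [this work] -/
theorem sahiPositive_pat4_iff (w : Sym2 V → unitInterval) (a b c d : V) :
    (∀ n, SahiPositive (pushWeight (bernoulliWeight w) (pat4 a b c d)) n) ↔
      0 ≤ sahiE4 (prodBernoulli w) (triConn b c d)ᶜ (triConn a c d)ᶜ (triConn a b d)ᶜ (triConn a b c)ᶜ := by
  rw [M4.sahiPositive_iff_two_and_row (pushWeight_pat4_nonneg w a b c d) (sum_pushWeight_pat4 w a b c d), pat4_quartic_eq]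
  exact ⟨fun h => h.2, fun h => ⟨sahiPositive_two_pat4 w a b c d, h⟩⟩

/-- **All orders from the row, at one graph and one quadruple of terminals**: if `E₄(D_a, D_b, D_c, D_d) ≥ 0` then
`E_n(f₀ ∘ pat4, …, f_{n−1} ∘ pat4) ≥ 0` under the percolation weight for every `n` and all nonnegative `f_i : M₄ → ℝ` increasing from `core`
to `out` (nonnegative pattern-measurable functions DECREASING in the configuration). [this work] -/
theorem sahiE_fourPointPattern_nonneg_of_row (w : Sym2 V → unitInterval) (a b c d : V)
    (h4 : 0 ≤ sahiE4 (prodBernoulli w) (triConn b c d)ᶜ (triConn a c d)ᶜ (triConn a b d)ᶜ (triConn a b c)ᶜ) {n : ℕ}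
    (f : Fin n → M4 → ℝ) (hf0 : ∀ i x, 0 ≤ f i x) (hmono : ∀ i, Monotone (f i)) :
    0 ≤ sahiE (bernoulliWeight w) n fun i => f i ∘ pat4 a b c d := by
  rw [← sahiE_pushWeight]
  exact (sahiPositive_pat4_iff w a b c d).2 h4 n f hf0 hmono

/-- **`4PT-LB` ⟺ every order on every four-point all-but-one-joined algebra**: the open row `FourPointLBRow` holds iff the four-point pattern
weight of EVERY finite weighted graph is Sahi-positive of EVERY order (the `m = 4` rung of the sunflower tower carries its whole hierarchy).
[this work] -/
theorem fourPointLBRow_iff_allOrders :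
    FourPointLBRow ↔ ∀ (V : Type) [Fintype V] (w : Sym2 V → unitInterval) (a b c d : V) (n : ℕ),
      SahiPositive (pushWeight (bernoulliWeight w) (pat4 a b c d)) n :=
  ⟨fun h V _ w a b c d n => (sahiPositive_pat4_iff w a b c d).2 (h V w a b c d) n,
    fun h V _ w a b c d => (sahiPositive_pat4_iff w a b c d).1 (h V w a b c d)⟩

end Summit.CriticalPhenomena.PercolationContinuityZ3.Theorems.SahiDeltaSystem
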